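import Summits.HubbardSuperconductivity.HubbardSuperconductivity.Theorems.DeformationLadderLowEnergyRigidityTelescopeDefs

/-!
# Route `DeformationLadder`, crux `LowEnergyRigidity` (item `stmt-HubbardSuperconductivity-1892`):
# the Poincaré telescope, I — nested cells and the `2 × 2` refinement inequality

Support file (`--supports stmt-HubbardSuperconductivity-1892`) for the crux idea `poincare-telescope`
(ideator 3, round 1; `Cruxes/LowEnergyRigidity/Ideas/poincare-telescope.md`), over the vocabulary of
`DeformationLadderLowEnergyRigidityTelescopeDefs` (`cellIndex`, `cellOf`, `cellPair`, `cellCoherence`,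
`cellDirichlet`, `parent`, `offset`, `child`).

Cell combinatorics:
* `cellPair_one`, `cellCoherence_one` — at cell count `1` the single cell carries the whole pair field,
  `𝒞_1 = Δ_dᴴ Δ_d` (the top of the telescope is the crux's LRO operator itself);
* `parent_child`, `offset_child`, `child_parent_offset`, `eq_child_iff`, `sum_cells_eq_sum_parent_child` —
  `(B, s) ↦ child k B s` is a bijection `(ℤ/kℤ)² × {0,1}² → (ℤ/2kℤ)²`, so sums over cells regroup by parent;
* `parent_cellOf` — NESTING: the parent of the `2k`-cell of a site is its `k`-cell
  (`⌊⌊2kx/L⌋/2⌋ = ⌊kx/L⌋`), for every `L` (no divisibility needed);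
* `cellPair_parent` — hence the pair field of a parent cell is the sum of its four children's;
* `child_add_single` — the four children of a parent form a `2 × 2` square of the cell torus `(ℤ/2kℤ)²`
  (its four bonds are among the directed bonds summed in `𝒟_{2k}`).

The refinement inequality:
* `expect_conjTranspose_mul_self`, `re_expect_sum` — quadratic-form bookkeeping (`⟨φ, AᴴA φ⟩ = ‖Aφ‖²`);
* `square_identity`, `square_poincare` — the Poincaré inequality of the `4`-cycle (spectral gap
  `λ₁ = 2`) for four VECTORS, as the exact identity
  `|a+b+c+d|² − 4Σ|·|² + 2Σ_bonds|·−·|² = |a−b−c+d|²` (the alternating mode carries the only slack);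
* `re_expect_parent_ge`, `re_expect_cellCoherence_ge` — the **refinement inequality**
  `4 Re⟨𝒞_{2k}⟩ − 2 Re⟨𝒟_{2k}⟩ ≤ Re⟨𝒞_k⟩` in every state (square inequality for the four child pair
  fields of each parent, `Δ_B = Σ Δ_child`, and the four intra-parent bonds bounded by all eight directed
  bonds leaving the children, `cellDirichlet` being a sum of positive terms). In density units
  (`ρ_k = (k²/L⁴)𝒞_k`, `ρ_1 =` LRO) it reads `ρ_k ≥ ρ_{2k} − ((2k)²/(2L⁴)) 𝒟_{2k}` — the `m = 2` grid
  operator Poincaré step of the card (`λ₁^N(2) = 2 − 2cos(π/2) = 2`), with no commutativity of the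
  `Δ_b` used and no Fourier analysis.

Companions: `…TelescopeTorus` (the sharp torus operator Poincaré inequality
`Δ_dᴴΔ_d ⪰ k²𝒞_k − (k²/λ₁)𝒟_k`, `λ₁ = 2 − 2cos(2π/k)`, by Plancherel over the cell torus — the top step),
`…TelescopeReduction` (the dyadic telescope `4, 8, 16, …` closing `LowEnergyRigidity` from the two inputs),
`…TelescopeOperator` (the Gram lemma = the card's first lemma, and the operator forms),
`…TelescopeNormalForms` (ground-energy forms of the two inputs).
All elementary [folklore]; source of the construction: the idea card (2026-08-16).
-/

noncomputable section

namespace Summit.HubbardSuperconductivity.HubbardSuperconductivity.Theorems.LowEnergyRigidity.Telescope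

set_option linter.dupNamespace false -- summit = problem name (single-conjunct summit), D-0017

open Matrix
open scoped ComplexOrder
open Literature.MathematicalPhysics.QuantumLattice Literature.Probability.LatticeModels



/-! ### One cell: `k = 1` -/

/-- At cell count `1` there is a single cell, whose pair field is the whole `d`-wave pair field. [folklore] -/
theorem cellPair_one (L : ℕ) [NeZero L] (b : TorusSite 2 1) :
    cellPair L 1 b = pairField dWaveFormFactor L := by
  unfold cellPair pairField
  refine Finset.sum_congr ?_ fun _ _ => rfl
  ext x
  simp only [Finset.mem_filter, Finset.mem_univ, true_and, iff_true]
  exact Subsingleton.elim _ _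

/-- `𝒞_1 = Δ_dᴴ Δ_d`. [folklore] -/
theorem cellCoherence_one (L : ℕ) [NeZero L] :
    cellCoherence L 1 = (pairField dWaveFormFactor L)ᴴ * pairField dWaveFormFactor L := by
  unfold cellCoherence
  rw [Fintype.sum_subsingleton _ (0 : TorusSite 2 1), cellPair_one]

/-! ### Dyadic refinement `k ↦ 2k`: parents, children, nesting -/

section Dyadic

variable (k : ℕ) [NeZero k]

/-- The child coordinates `2 B_i + s_i` are below `2k`. [folklore] -/
theorem two_mul_val_add_lt (B : TorusSite 2 k) (s : Fin 2 → Fin 2) (i : Fin 2) :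
    2 * (B i).val + (s i).val < 2 * k := by
  have h1 : (B i).val < k := ZMod.val_lt _
  have h2 : (s i).val < 2 := (s i).isLt
  omega

/-- The coordinate representatives of a child: `(child k B s i).val = 2 (B i).val + s i`. [folklore] -/
theorem child_val (B : TorusSite 2 k) (s : Fin 2 → Fin 2) (i : Fin 2) :
    (child k B s i).val = 2 * (B i).val + (s i).val := by
  unfold child
  exact ZMod.val_cast_of_lt (two_mul_val_add_lt k B s i)

/-- The parent of a child of `B` is `B`. [folklore] -/
theorem parent_child (B : TorusSite 2 k) (s : Fin 2 → Fin 2) : parent k (child k B s) = B := by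
  funext i
  simp only [parent, child_val]
  have h2 : (s i).val < 2 := (s i).isLt
  have : (2 * (B i).val + (s i).val) / 2 = (B i).val := by omega
  rw [this, ZMod.natCast_zmod_val]

/-- The position of the child of `B` at position `s` is `s`. [folklore] -/
theorem offset_child (B : TorusSite 2 k) (s : Fin 2 → Fin 2) : offset k (child k B s) = s := by
  funext i
  apply Fin.ext
  simp only [offset, child_val]
  have h2 : (s i).val < 2 := (s i).isLt
  omega

/-- Every cell at count `2k` is the child of its parent at its own position. [folklore] -/
theorem child_parent_offset (b : TorusSite 2 (2 * k)) : child k (parent k b) (offset k b) = b := by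
  funext i
  apply ZMod.val_injective
  rw [child_val]
  simp only [parent, offset]
  have hb : (b i).val < 2 * k := ZMod.val_lt _
  have hk : (b i).val / 2 < k := by omega
  rw [ZMod.val_cast_of_lt hk]
  omega

/-- `b` is the child of `B` at position `s` iff its parent is `B` and its position is `s`. [folklore] -/
theorem eq_child_iff (b : TorusSite 2 (2 * k)) (B : TorusSite 2 k) (s : Fin 2 → Fin 2) :
    b = child k B s ↔ parent k b = B ∧ offset k b = s := by
  constructor
  · rintro rfl
    exact ⟨parent_child k B s, offset_child k B s⟩
  · rintro ⟨rfl, rfl⟩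
    exact (child_parent_offset k b).symm

/-- Sums over cells at count `2k`, grouped by parent. [folklore] -/
theorem sum_cells_eq_sum_parent_child {M : Type*} [AddCommMonoid M] (F : TorusSite 2 (2 * k) → M) :
    ∑ b : TorusSite 2 (2 * k), F b = ∑ B : TorusSite 2 k, ∑ s : Fin 2 → Fin 2, F (child k B s) := by
  rw [← Fintype.sum_prod_type']
  refine (Fintype.sum_bijective (fun p : TorusSite 2 k × (Fin 2 → Fin 2) => child k p.1 p.2)
    ?_ _ _ fun p => rfl).symm
  refine Function.bijective_iff_has_inverse.mpr ⟨fun b => (parent k b, offset k b), ?_, ?_⟩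
  · rintro ⟨B, s⟩
    simp only [parent_child, offset_child]
  · intro b
    exact child_parent_offset k b

variable (L : ℕ) [NeZero L]

/-- NESTING of the cell partitions: the parent of the `2k`-cell of a site is its `k`-cell. [folklore] -/
theorem parent_cellOf (x : TorusSite 2 L) : parent k (cellOf L (2 * k) x) = cellOf L k x := by
  funext i
  simp only [parent, cellOf, cellIndex]
  congr 1
  have hx : (x i).val < L := ZMod.val_lt _
  have hL : 0 < L := Nat.pos_of_ne_zero (NeZero.ne L)
  have hlt : (x i).val * (2 * k) / L < 2 * k := by
    rw [Nat.div_lt_iff_lt_mul hL]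
    have h2k : 0 < 2 * k := Nat.mul_pos two_pos (Nat.pos_of_ne_zero (NeZero.ne k))
    calc (x i).val * (2 * k) < L * (2 * k) := Nat.mul_lt_mul_of_pos_right hx h2k
      _ = 2 * k * L := mul_comm _ _
  rw [ZMod.val_cast_of_lt hlt]
  rw [Nat.div_div_eq_div_mul]
  calc (x i).val * (2 * k) / (L * 2) = ((x i).val * k * 2) / (L * 2) := by ring_nf
    _ = (x i).val * k / L := Nat.mul_div_mul_right _ _ two_pos

/-- The pair field of a parent cell is the sum of the pair fields of its four children. [folklore] -/
theorem cellPair_parent (B : TorusSite 2 k) :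
    cellPair L k B = ∑ s : Fin 2 → Fin 2, cellPair L (2 * k) (child k B s) := by
  classical
  unfold cellPair
  -- regroup the sites of the parent cell by the position of their `2k`-cell
  have h := Finset.sum_fiberwise (Finset.univ.filter fun x : TorusSite 2 L => cellOf L k x = B)
    (fun x => offset k (cellOf L (2 * k) x)) (fun x => localPair dWaveFormFactor L x)
  rw [← h]
  refine Finset.sum_congr rfl fun s _ => Finset.sum_congr ?_ fun _ _ => rfl
  ext x
  simp only [Finset.mem_filter, Finset.mem_univ, true_and]
  rw [← parent_cellOf k L x, ← eq_child_iff]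

omit [NeZero k] in
/-- Moving to the neighbouring child inside the parent: if `s i = 0` then the `i`-neighbour of the
child at position `s` is the child at position `s` with `s i` set to `1`. [folklore] -/
theorem child_add_single (B : TorusSite 2 k) (s : Fin 2 → Fin 2) (i : Fin 2) (hs : s i = 0) :
    child k B s + Pi.single i 1 = child k B (Function.update s i 1) := by
  funext j
  by_cases hj : j = i
  · subst hj
    simp only [child, Pi.add_apply, Pi.single_eq_same, Function.update_self, hs, Fin.val_zero,
      add_zero, Fin.val_one]
    push_cast
    ring
  · simp only [child, Pi.add_apply, Pi.single_eq_of_ne hj, add_zero, Function.update_of_ne hj]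

/-- Sums over the four positions `s : Fin 2 → Fin 2`, written out. [folklore] -/
theorem sum_arrow_fin_two {M : Type*} [AddCommMonoid M] (f : (Fin 2 → Fin 2) → M) :
    ∑ s : Fin 2 → Fin 2, f s = f ![0, 0] + f ![0, 1] + f ![1, 0] + f ![1, 1] := by
  rw [← Fintype.sum_equiv (finTwoArrowEquiv (Fin 2)).symm (fun p => f ((finTwoArrowEquiv (Fin 2)).symm p))
    f fun p => rfl]
  rw [Fintype.sum_prod_type]
  simp only [Fin.sum_univ_two]
  simp only [finTwoArrowEquiv, piFinTwoEquiv, Equiv.coe_fn_symm_mk, add_assoc]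

end Dyadic

/-! ### Quadratic forms: expectations of `Aᴴ A` and of sums -/

section Forms

variable {ι : Type*} [Fintype ι]

/-- `⟨φ, Aᴴ A φ⟩ = ⟨A φ, A φ⟩`. [folklore] -/
theorem expect_conjTranspose_mul_self (A : Matrix (Finset ι) (Finset ι) ℂ) (φ : Fock ι) :
    expect (Aᴴ * A) φ = star (A *ᵥ φ) ⬝ᵥ (A *ᵥ φ) := by
  unfold expect
  rw [← mulVec_mulVec, dotProduct_mulVec, vecMul_conjTranspose, star_star]

/-- `Re ⟨φ, Aᴴ A φ⟩ ≥ 0`. [folklore] -/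
theorem re_expect_conjTranspose_mul_self_nonneg (A : Matrix (Finset ι) (Finset ι) ℂ) (φ : Fock ι) :
    0 ≤ (expect (Aᴴ * A) φ).re := by
  rw [expect_conjTranspose_mul_self]
  exact (Complex.nonneg_iff.mp (dotProduct_star_self_nonneg _)).1

/-- Expectations are additive over finite sums of operators (real parts). [folklore] -/
theorem re_expect_sum {α : Type*} (s : Finset α) (f : α → Matrix (Finset ι) (Finset ι) ℂ)
    (φ : Fock ι) : (expect (∑ a ∈ s, f a) φ).re = ∑ a ∈ s, (expect (f a) φ).re := by
  unfold expect
  rw [Matrix.sum_mulVec, dotProduct_sum, Complex.re_sum]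

/-- The `2 × 2`-square Poincaré identity for four vectors (cycle `a – b – d – c – a`):
`|a+b+c+d|² − 4(|a|²+|b|²+|c|²+|d|²) + 2(|a−b|²+|a−c|²+|c−d|²+|b−d|²) = |a−b−c+d|²`. [folklore] -/
theorem square_identity {n : Type*} [Fintype n] (a b c d : n → ℂ) :
    star (a + b + c + d) ⬝ᵥ (a + b + c + d)
      - 4 * (star a ⬝ᵥ a + star b ⬝ᵥ b + star c ⬝ᵥ c + star d ⬝ᵥ d)
      + 2 * (star (a - b) ⬝ᵥ (a - b) + star (a - c) ⬝ᵥ (a - c) + star (c - d) ⬝ᵥ (c - d)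
          + star (b - d) ⬝ᵥ (b - d))
      = star (a - b - c + d) ⬝ᵥ (a - b - c + d) := by
  simp only [star_add, star_sub, add_dotProduct, sub_dotProduct, dotProduct_add, dotProduct_sub]
  ring

/-- The `2 × 2`-square Poincaré INEQUALITY for four vectors (spectral gap `2` of the `4`-cycle):
`4(|a|²+|b|²+|c|²+|d|²) − 2(|a−b|²+|a−c|²+|c−d|²+|b−d|²) ≤ |a+b+c+d|²`. [folklore] -/
theorem square_poincare {n : Type*} [Fintype n] (a b c d : n → ℂ) :
    4 * ((star a ⬝ᵥ a).re + (star b ⬝ᵥ b).re + (star c ⬝ᵥ c).re + (star d ⬝ᵥ d).re)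
      - 2 * ((star (a - b) ⬝ᵥ (a - b)).re + (star (a - c) ⬝ᵥ (a - c)).re + (star (c - d) ⬝ᵥ (c - d)).re
          + (star (b - d) ⬝ᵥ (b - d)).re)
      ≤ (star (a + b + c + d) ⬝ᵥ (a + b + c + d)).re := by
  have h := congrArg Complex.re (square_identity a b c d)
  have hw : 0 ≤ (star (a - b - c + d) ⬝ᵥ (a - b - c + d)).re :=
    (Complex.nonneg_iff.mp (dotProduct_star_self_nonneg _)).1
  simp only [Complex.add_re, Complex.sub_re, Complex.mul_re, Complex.re_ofNat, Complex.im_ofNat,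
    zero_mul, sub_zero] at h
  linarith

end Forms

/-! ### The refinement inequality `𝒞_k ≥ 4 𝒞_{2k} − 2 𝒟_{2k}` (expectation form) -/

section Refinement

variable (L : ℕ) [NeZero L] (k : ℕ) [NeZero k]

/-- Per parent cell: the square Poincaré inequality for the four child pair fields, with the four
intra-parent bonds bounded by all eight directed bonds leaving the children. [folklore] -/
theorem re_expect_parent_ge (B : TorusSite 2 k) (φ : Fock (Orb (FermionTorus 2 L))) :
    4 * ∑ s : Fin 2 → Fin 2, (expect ((cellPair L (2 * k) (child k B s))ᴴ * cellPair L (2 * k) (child k B s)) φ).re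
      - 2 * ∑ s : Fin 2 → Fin 2, ∑ i : Fin 2,
          (expect ((cellPair L (2 * k) (child k B s) - cellPair L (2 * k) (child k B s + Pi.single i 1))ᴴ *
            (cellPair L (2 * k) (child k B s) - cellPair L (2 * k) (child k B s + Pi.single i 1))) φ).re
      ≤ (expect ((cellPair L k B)ᴴ * cellPair L k B) φ).re := by
  -- the four child vectors
  set v : (Fin 2 → Fin 2) → Fock (Orb (FermionTorus 2 L)) := fun s => cellPair L (2 * k) (child k B s) *ᵥ φ
    with hv
  have hsq := square_poincare (v ![0, 0]) (v ![1, 0]) (v ![0, 1]) (v ![1, 1])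
  -- parent vector = sum of the four child vectors
  have hpar : cellPair L k B *ᵥ φ = v ![0, 0] + v ![1, 0] + v ![0, 1] + v ![1, 1] := by
    rw [cellPair_parent k L B, Matrix.sum_mulVec, sum_arrow_fin_two]
    simp only [hv]
    abel
  -- neighbours inside the parent
  have e1 : child k B ![0, 0] + Pi.single 0 1 = child k B ![1, 0] := by
    rw [child_add_single k B _ 0 rfl]; congr 1; ext j; fin_cases j <;> rfl
  have e2 : child k B ![0, 0] + Pi.single 1 1 = child k B ![0, 1] := by
    rw [child_add_single k B _ 1 rfl]; congr 1; ext j; fin_cases j <;> rfl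
  have e3 : child k B ![0, 1] + Pi.single 0 1 = child k B ![1, 1] := by
    rw [child_add_single k B _ 0 rfl]; congr 1; ext j; fin_cases j <;> rfl
  have e4 : child k B ![1, 0] + Pi.single 1 1 = child k B ![1, 1] := by
    rw [child_add_single k B _ 1 rfl]; congr 1; ext j; fin_cases j <;> rfl
  -- rewrite all expectations as squared norms of vectors
  simp only [expect_conjTranspose_mul_self, sub_mulVec]
  rw [sum_arrow_fin_two, sum_arrow_fin_two]
  simp only [Fin.sum_univ_two, e1, e2, e3, e4, hpar]
  -- the four dropped bond terms are nonnegative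
  have n1 : 0 ≤ (star (cellPair L (2 * k) (child k B ![1, 0]) *ᵥ φ -
      cellPair L (2 * k) (child k B ![1, 0] + Pi.single 0 1) *ᵥ φ) ⬝ᵥ
      (cellPair L (2 * k) (child k B ![1, 0]) *ᵥ φ -
      cellPair L (2 * k) (child k B ![1, 0] + Pi.single 0 1) *ᵥ φ)).re :=
    (Complex.nonneg_iff.mp (dotProduct_star_self_nonneg _)).1
  have n2 : 0 ≤ (star (cellPair L (2 * k) (child k B ![0, 1]) *ᵥ φ -
      cellPair L (2 * k) (child k B ![0, 1] + Pi.single 1 1) *ᵥ φ) ⬝ᵥ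
      (cellPair L (2 * k) (child k B ![0, 1]) *ᵥ φ -
      cellPair L (2 * k) (child k B ![0, 1] + Pi.single 1 1) *ᵥ φ)).re :=
    (Complex.nonneg_iff.mp (dotProduct_star_self_nonneg _)).1
  have n3 : 0 ≤ (star (cellPair L (2 * k) (child k B ![1, 1]) *ᵥ φ -
      cellPair L (2 * k) (child k B ![1, 1] + Pi.single 0 1) *ᵥ φ) ⬝ᵥ
      (cellPair L (2 * k) (child k B ![1, 1]) *ᵥ φ -
      cellPair L (2 * k) (child k B ![1, 1] + Pi.single 0 1) *ᵥ φ)).re :=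
    (Complex.nonneg_iff.mp (dotProduct_star_self_nonneg _)).1
  have n4 : 0 ≤ (star (cellPair L (2 * k) (child k B ![1, 1]) *ᵥ φ -
      cellPair L (2 * k) (child k B ![1, 1] + Pi.single 1 1) *ᵥ φ) ⬝ᵥ
      (cellPair L (2 * k) (child k B ![1, 1]) *ᵥ φ -
      cellPair L (2 * k) (child k B ![1, 1] + Pi.single 1 1) *ᵥ φ)).re :=
    (Complex.nonneg_iff.mp (dotProduct_star_self_nonneg _)).1
  simp only [hv] at hsq
  linarith

/-- **Refinement inequality** (the `2 × 2` grid operator Poincaré step, expectation form):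
`4 Re⟨φ, 𝒞_{2k} φ⟩ − 2 Re⟨φ, 𝒟_{2k} φ⟩ ≤ Re⟨φ, 𝒞_k φ⟩` for every vector `φ`. [folklore] -/
theorem re_expect_cellCoherence_ge (φ : Fock (Orb (FermionTorus 2 L))) :
    4 * (expect (cellCoherence L (2 * k)) φ).re - 2 * (expect (cellDirichlet L (2 * k)) φ).re ≤
      (expect (cellCoherence L k) φ).re := by
  unfold cellCoherence cellDirichlet
  rw [re_expect_sum, re_expect_sum, re_expect_sum,
    sum_cells_eq_sum_parent_child k, sum_cells_eq_sum_parent_child k, Finset.mul_sum, Finset.mul_sum,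
    ← Finset.sum_sub_distrib]
  refine Finset.sum_le_sum fun B _ => ?_
  have h := re_expect_parent_ge L k B φ
  simp only [re_expect_sum] at h ⊢
  exact h

end Refinement

end Summit.HubbardSuperconductivity.HubbardSuperconductivity.Theorems.LowEnergyRigidity.Telescope
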